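import Summits.Ventures.HodgeRepro.CMRank

/-!
# Transport of the CM-type vocabulary along isomorphisms of Galois groups

Blind re-derivation cell `pub-hodge-repro`, seat `typer` (gen 2).  Continues `CMType.lean` /
`HodgeSets.lean` / `CMRank.lean`.

Everything in the finite-group model is invariant under an isomorphism `e : G ≃* G'` of groups carrying
the complex conjugation `c` to `e c`: CM types go to CM types (`IsCMType.map`), Pohlmann's condition is
preserved (`isHodgeSet_mapSet_iff`), the Hodge counts agree (`hodgeCount_mapSet`) and the rank of the CM
type is unchanged (`cmRank_mapSet`).  This is what lets a statement about an ABSTRACT Galois group of order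
`6`, `8` or `12` be settled on the CONCRETE Mathlib groups of `Groups.lean` once `G` is identified with one
of them.
-/

open Finset
open scoped Pointwise

namespace HodgeRepro

variable {G G' : Type*} [Group G] [Group G'] [DecidableEq G] [DecidableEq G']

/-- Transport of a subset of `G` (a set of embeddings) along a group isomorphism `e : G ≃* G'`. -/
def mapSet (e : G ≃* G') (S : Finset G) : Finset G' := S.map e.toEquiv.toEmbedding

omit [DecidableEq G] [DecidableEq G'] in
/-- Membership in a transported set. -/
@[simp] theorem mem_mapSet (e : G ≃* G') (S : Finset G) (x : G') :
    x ∈ mapSet e S ↔ e.symm x ∈ S :=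
  Finset.mem_map_equiv

omit [DecidableEq G] [DecidableEq G'] in
/-- Transport along `e` then `e.symm` is the identity. -/
theorem mapSet_symm_mapSet (e : G ≃* G') (S : Finset G) : mapSet e.symm (mapSet e S) = S := by
  ext x; simp

omit [DecidableEq G] [DecidableEq G'] in
/-- Transport along `e.symm` then `e` is the identity. -/
theorem mapSet_mapSet_symm (e : G ≃* G') (S : Finset G') : mapSet e (mapSet e.symm S) = S := by
  ext x; simp

omit [DecidableEq G] [DecidableEq G'] in
/-- Transport is injective. -/
theorem mapSet_injective (e : G ≃* G') : Function.Injective (mapSet e) := by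
  intro S T h
  rw [← mapSet_symm_mapSet e S, h, mapSet_symm_mapSet]

omit [DecidableEq G] [DecidableEq G'] in
/-- Transport preserves cardinality. -/
@[simp] theorem card_mapSet (e : G ≃* G') (S : Finset G) : (mapSet e S).card = S.card :=
  Finset.card_map _

/-- Transport commutes with intersections. -/
theorem mapSet_inter (e : G ≃* G') (S T : Finset G) :
    mapSet e (S ∩ T) = mapSet e S ∩ mapSet e T := by
  ext x; simp

/-- Transport commutes with complements. -/
theorem mapSet_compl [Fintype G] [Fintype G'] (e : G ≃* G') (S : Finset G) :
    mapSet e Sᶜ = (mapSet e S)ᶜ := by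
  ext x; simp

/-- Transport commutes with the Galois action: `e (g • S) = (e g) • e S`. -/
theorem mapSet_smul (e : G ≃* G') (g : G) (S : Finset G) :
    mapSet e (g • S) = e g • mapSet e S := by
  ext x
  rw [mem_mapSet, ← inv_smul_mem_iff, ← inv_smul_mem_iff, mem_mapSet, smul_eq_mul, smul_eq_mul,
    map_mul, map_inv, MulEquiv.symm_apply_apply]

/-- Membership in a translate of a transported set, read back in `G`. -/
theorem mem_smul_mapSet (e : G ≃* G') (g' x : G') (S : Finset G) :
    x ∈ g' • mapSet e S ↔ e.symm x ∈ e.symm g' • S := by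
  rw [← inv_smul_mem_iff, ← inv_smul_mem_iff, mem_mapSet, smul_eq_mul, smul_eq_mul, map_mul, map_inv]

omit [DecidableEq G] [DecidableEq G'] in
/-- Transport of the full set. -/
@[simp] theorem mapSet_univ [Fintype G] [Fintype G'] (e : G ≃* G') : mapSet e univ = univ := by
  ext x; simp

omit [DecidableEq G] [DecidableEq G'] in
/-- Complex conjugation is transported to complex conjugation. -/
theorem IsComplexConj.map {c : G} (hc : IsComplexConj c) (e : G ≃* G') : IsComplexConj (e c) where
  ne_one := e.map_ne_one_iff.2 hc.ne_one
  mul_self := by rw [← map_mul, hc.mul_self, map_one]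
  comm := fun g' => by
    obtain ⟨g, rfl⟩ := e.surjective g'
    rw [← map_mul, ← map_mul, hc.comm]

omit [DecidableEq G] [DecidableEq G'] in
/-- CM types are transported to CM types. -/
theorem IsCMType.map {c : G} {Φ : Finset G} (hΦ : IsCMType c Φ) (e : G ≃* G') :
    IsCMType (e c) (mapSet e Φ) := by
  intro x
  rw [mem_mapSet, mem_mapSet, map_mul, MulEquiv.symm_apply_apply]
  exact hΦ (e.symm x)

omit [DecidableEq G] [DecidableEq G'] in
/-- `Φ` is a CM type iff its transport is one. -/
theorem isCMType_mapSet_iff (c : G) (Φ : Finset G) (e : G ≃* G') :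
    IsCMType (e c) (mapSet e Φ) ↔ IsCMType c Φ := by
  refine ⟨fun h => ?_, fun h => h.map e⟩
  have := h.map e.symm
  rwa [mapSet_symm_mapSet, MulEquiv.symm_apply_apply] at this

/-- Pohlmann's condition is invariant under transport. -/
theorem isHodgeSet_mapSet_iff (c : G) (Φ Δ : Finset G) (e : G ≃* G') :
    IsHodgeSet (e c) (mapSet e Φ) (mapSet e Δ) ↔ IsHodgeSet c Φ Δ := by
  rw [isHodgeSet_iff_forall_inter_eq, isHodgeSet_iff_forall_inter_eq]
  constructor
  · intro h g
    have := h (e g)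
    rwa [← mapSet_smul, ← mapSet_smul, ← mapSet_smul, ← mapSet_inter, ← mapSet_inter, card_mapSet,
      card_mapSet] at this
  · intro h g'
    obtain ⟨g, rfl⟩ := e.surjective g'
    rw [← mapSet_smul, ← mapSet_smul, ← mapSet_smul, ← mapSet_inter, ← mapSet_inter, card_mapSet,
      card_mapSet]
    exact h g

/-- Pohlmann sets are transported to Pohlmann sets. -/
theorem IsHodgeSet.map {c : G} {Φ Δ : Finset G} (h : IsHodgeSet c Φ Δ) (e : G ≃* G') :
    IsHodgeSet (e c) (mapSet e Φ) (mapSet e Δ) :=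
  (isHodgeSet_mapSet_iff c Φ Δ e).2 h

section Counts

variable [Fintype G] [Fintype G']

omit [DecidableEq G] [DecidableEq G'] in
/-- The orders of isomorphic groups agree. -/
theorem card_eq_of_mulEquiv (e : G ≃* G') : Fintype.card G' = Fintype.card G :=
  (Fintype.card_congr e.toEquiv).symm

/-- The Hodge counts are invariant under transport. -/
theorem hodgeCount_mapSet (c : G) (Φ : Finset G) (e : G ≃* G') (p : ℕ) :
    hodgeCount (e c) (mapSet e Φ) p = hodgeCount c Φ p := by
  unfold hodgeCount
  symm
  refine Finset.card_bij (fun Δ _ => mapSet e Δ) ?_ ?_ ?_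
  · intro Δ hΔ
    simp only [mem_filter, mem_univ, true_and] at hΔ ⊢
    exact ⟨by rw [card_mapSet, hΔ.1], hΔ.2.map e⟩
  · intro Δ₁ _ Δ₂ _ h
    exact mapSet_injective e h
  · intro Δ' hΔ'
    refine ⟨mapSet e.symm Δ', ?_, mapSet_mapSet_symm e Δ'⟩
    simp only [mem_filter, mem_univ, true_and] at hΔ' ⊢
    refine ⟨by rw [card_mapSet, hΔ'.1], ?_⟩
    have := hΔ'.2.map e.symm
    rwa [mapSet_symm_mapSet, MulEquiv.symm_apply_apply] at this

/-- The divisor counts are invariant under transport. -/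
theorem divisorCount_mapSet (c : G) (e : G ≃* G') (p : ℕ) :
    divisorCount (e c) p = divisorCount c p := by
  unfold divisorCount
  symm
  refine Finset.card_bij (fun Δ _ => mapSet e Δ) ?_ ?_ ?_
  · intro Δ hΔ
    simp only [mem_filter, mem_univ, true_and] at hΔ ⊢
    exact ⟨by rw [card_mapSet, hΔ.1], by rw [← mapSet_smul, hΔ.2]⟩
  · intro Δ₁ _ Δ₂ _ h
    exact mapSet_injective e h
  · intro Δ' hΔ'
    refine ⟨mapSet e.symm Δ', ?_, mapSet_mapSet_symm e Δ'⟩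
    simp only [mem_filter, mem_univ, true_and] at hΔ' ⊢
    refine ⟨by rw [card_mapSet, hΔ'.1], ?_⟩
    have := congrArg (mapSet e.symm) hΔ'.2
    rwa [mapSet_smul, MulEquiv.symm_apply_apply] at this

/-- The exceptional counts are invariant under transport. -/
theorem exceptionalCount_mapSet {c : G} (hc : IsComplexConj c) (Φ : Finset G) (e : G ≃* G') (p : ℕ) :
    exceptionalCount (e c) (mapSet e Φ) p = exceptionalCount c Φ p := by
  have h1 := hodgeCount_eq_add (hc.map e) (Φ := mapSet e Φ) p
  have h2 := hodgeCount_eq_add hc (Φ := Φ) p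
  rw [hodgeCount_mapSet, divisorCount_mapSet] at h1
  omega

omit [Fintype G] [Fintype G'] in
/-- The type matrix of a transported CM type is the type matrix of the original, reindexed. -/
theorem typeMatrix_mapSet (Φ : Finset G) (e : G ≃* G') :
    typeMatrix (mapSet e Φ) = (typeMatrix Φ).submatrix e.symm.toEquiv e.symm.toEquiv := by
  ext g' x
  simp only [typeMatrix_apply, Matrix.submatrix_apply, MulEquiv.toEquiv_eq_coe, EquivLike.coe_coe,
    mem_smul_mapSet]

/-- The rank of a CM type is invariant under transport. -/
theorem cmRank_mapSet (Φ : Finset G) (e : G ≃* G') : cmRank (mapSet e Φ) = cmRank Φ := by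
  unfold cmRank
  rw [typeMatrix_mapSet, Matrix.rank_submatrix]

/-- Nondegeneracy is invariant under transport. -/
theorem isNondegenerate_mapSet_iff (Φ : Finset G) (e : G ≃* G') :
    IsNondegenerate (mapSet e Φ) ↔ IsNondegenerate Φ := by
  unfold IsNondegenerate
  rw [cmRank_mapSet, card_mapSet]

end Counts

end HodgeRepro
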